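import Summits.CriticalPhenomena.PercolationContinuityZ3.Theorems.SubpolynomialBlocking.Negative.Strengthenings
import HarnessLib

/-!
# Crux `PercNonProliferation.SubpolynomialBlocking` (stmt-CriticalPhenomena-4446), line `root-trick-wall-patch` — stub `stub_blockProbRatio_mono`

Helper file for the lead's skeleton of the line `root-trick-wall-patch` of the crux
`Summit.CriticalPhenomena.PercolationContinuityZ3.Theses.PercNonProliferation.SubpolynomialBlocking`.
Proves exactly the registered stub signature `stub_blockProbRatio_mono`; lands with
`--supports stmt-CriticalPhenomena-4446`.

## The statement (ratio monotonicity `u^{(R)}_n ≤ u^{(R')}_n`)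

For the ratio-`R` blocking probability
`u^{(R)}_n(d, p) = P_p(¬ ∃ x ∈ Λ_n, ∃ y ∈ ∂ⁱⁿΛ_{Rn}, x ⟷ y in Λ_{Rn})` on `ℤ^d`
(`Λ_k = box d k = [-k, k]^d`), and `1 ≤ R ≤ R'`: `u^{(R)}_n ≤ u^{(R')}_n` (every `d`, every `p`,
every `n`).

## The argument (first exit)

The measure `P_p` is carried by lattice configurations `ω ⊆ E(ℤ^d)`
(`DCT16.real_mono_of_forall_subset_edgeSet`), so it suffices to show, for such `ω`, that a
ratio-`R'` crossing `x ∈ Λ_n`, `y ∈ ∂ⁱⁿΛ_{R'n}`, `x ⟷ y in Λ_{R'n}` contains a ratio-`R` crossing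
(`StubBlockProbRatioMono.exists_crossing_of_le`). If `Rn = R'n` there is nothing to do. Otherwise
`Rn < R'n`, `x ∈ Λ_n ⊆ Λ_{Rn}` (`box_mono`, `1 ≤ R`) and `y ∉ Λ_{Rn}`
(`DCT16.notMem_box_of_mem_innerBoundary_box`); the open path (`DCT16.mem_openConnIn_iff_pathIn`)
has a first exit edge `a ∼ b` from `Λ_{Rn}` (`PathIn.exit`), `a ∈ Λ_{Rn}`, `b ∉ Λ_{Rn}`, and
`a ∼ b` is a lattice edge (`DCT16.adj_of_openGraph_adj`), so `a ∈ ∂ⁱⁿΛ_{Rn}`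
(`mem_innerBoundary_iff`); the initial segment up to `a` is an open path inside `Λ_{Rn}`
(`PathIn.mono`, `DCT16.mem_openConnIn_of_pathIn`), i.e. `x ⟷ a in Λ_{Rn}`.

No new definitions; all sets are written exactly as in the registered signature.
-/

noncomputable section

namespace Summit.CriticalPhenomena.PercolationContinuityZ3.Theorems.SubpolynomialBlocking

open MeasureTheory Filter Topology
open Literature.Probability.Percolation Literature.Probability.LatticeModels

namespace StubBlockProbRatioMono

/-- **Deterministic core (first exit).** On a lattice configuration `ω ⊆ E(ℤ^d)`, for
`n ≤ m ≤ m'`, an open crossing from `Λ_n` to `∂ⁱⁿΛ_{m'}` inside `Λ_{m'}` contains an open crossing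
from `Λ_n` to `∂ⁱⁿΛ_m` inside `Λ_m`: stop the path at its first exit from `Λ_m`. -/
theorem exists_crossing_of_le {d n m m' : ℕ} (hnm : n ≤ m) (hmm' : m ≤ m')
    {ω : BondConfig (Site d)} (hω : ω ⊆ (zdGraph d).edgeSet)
    (h : ∃ x ∈ box d n, ∃ y ∈ innerBoundary (zdGraph d) (box d m'),
      ω ∈ openConnIn (↑(box d m') : Set (Site d)) x y) :
    ∃ x ∈ box d n, ∃ y ∈ innerBoundary (zdGraph d) (box d m),
      ω ∈ openConnIn (↑(box d m) : Set (Site d)) x y := by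
  obtain ⟨x, hx, y, hy, hxy⟩ := h
  rcases hmm'.eq_or_lt with rfl | hlt
  · exact ⟨x, hx, y, hy, hxy⟩
  have hpath := DCT16.mem_openConnIn_iff_pathIn.1 hxy
  have hxm : x ∈ (↑(box d m) : Set (Site d)) := Finset.mem_coe.2 (box_mono d hnm hx)
  have hym : y ∉ (↑(box d m) : Set (Site d)) := fun h' =>
    DCT16.notMem_box_of_mem_innerBoundary_box hlt hy (Finset.mem_coe.1 h')
  obtain ⟨a, b, ha, hb, -, hab, hpa⟩ := hpath.exit hxm hym
  refine ⟨x, hx, a, ?_, DCT16.mem_openConnIn_of_pathIn (hpa.mono Set.inter_subset_left)⟩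
  exact mem_innerBoundary_iff.2 ⟨Finset.mem_coe.1 ha, b, fun hb' => hb (Finset.mem_coe.2 hb'),
    DCT16.adj_of_openGraph_adj hω hab⟩

end StubBlockProbRatioMono

/-- **Registered stub `stub_blockProbRatio_mono`** (line `root-trick-wall-patch`, crux
`SubpolynomialBlocking`): RATIO MONOTONICITY of the blocking probability,
`u^{(R)}_n ≤ u^{(R')}_n` for `1 ≤ R ≤ R'` (every dimension `d`, every parameter `p`, every `n`),
where `u^{(R)}_n = P_p(Λ_n ↮ ∂ⁱⁿΛ_{Rn} in Λ_{Rn})`. Proof: almost surely `ω ⊆ E(ℤ^d)`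
(`DCT16.real_mono_of_forall_subset_edgeSet`), and on such configurations a ratio-`R'` crossing
contains a ratio-`R` crossing by first exit from `Λ_{Rn}`
(`StubBlockProbRatioMono.exists_crossing_of_le` with `n ≤ Rn ≤ R'n`). -/
theorem stub_blockProbRatio_mono : ∀ (d : ℕ) (p : unitInterval) (R R' n : ℕ), 1 ≤ R → R ≤ R' → (bondPercolation (zdGraph d) p).real {ω | ¬ ∃ x ∈ box d n, ∃ y ∈ innerBoundary (zdGraph d) (box d (R * n)), ω ∈ openConnIn (↑(box d (R * n)) : Set (Site d)) x y} ≤ (bondPercolation (zdGraph d) p).real {ω | ¬ ∃ x ∈ box d n, ∃ y ∈ innerBoundary (zdGraph d) (box d (R' * n)), ω ∈ openConnIn (↑(box d (R' * n)) : Set (Site d)) x y} := by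
  intro d p R R' n hR hRR'
  refine DCT16.real_mono_of_forall_subset_edgeSet (zdGraph d) p fun ω hω hblock hcross => hblock ?_
  exact StubBlockProbRatioMono.exists_crossing_of_le (Nat.le_mul_of_pos_left n hR)
    (Nat.mul_le_mul_right n hRR') hω hcross

end Summit.CriticalPhenomena.PercolationContinuityZ3.Theorems.SubpolynomialBlocking

end
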